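import Summits.AtomisticToContinuum.BoseEinsteinCondensation.Theorems.BECInsertionCorrectorStaticResponseBoundFreeSquare
import Summits.AtomisticToContinuum.BoseEinsteinCondensation.Theorems.BECInsertionCorrectorStaticResponseBoundModulationRealForm
import HarnessLib

/-!
# Mode pairing against a test function in the ground-state measure

Stub `stub_modePairing` of line `stable-fraction-square-completion` (seat c2, few-body layer) of
crux `BECInsertionCorrector.StaticResponseBound` (item stmt-AtomisticToContinuum-12057; this file
supports, does not close, the item).

For a real nonnegative periodic trial state `Φ` (`F = |Φ|`, real `C¹`, `Lℤ³`-periodic, `∫ F² = 1`),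
a real `C¹` lattice-periodic test function `η` and the density wave `V = ∑ⱼ cos θⱼ`,
`θⱼ(X) = p·xⱼ`, `p = 2πk/L`, `|p|² = psq L k`:

  `|p|² · |∫ V η F²| ≤ √(N|p|²) · (𝓔_F(η,η)^{1/2} + 2 (∫ η²F²)^{1/2} (∫ |∇F|²)^{1/2})`.

Proof. For a particle `j` and an axis `c` the flux `sin θⱼ · η F²` is `C¹` and lattice periodic
with `∂_{j,c}(sin θⱼ η F²) = p_c cos θⱼ η F² + sin θⱼ ∂_{j,c}η F² + 2 sin θⱼ ∂_{j,c}F η F`, so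
integration by parts on the torus (`integral_cellN_pderiv_eq_zero`) gives
`p_c ∫ cos θⱼ η F² + ∫ sin θⱼ ∂_{j,c}η F² + 2 ∫ sin θⱼ ∂_{j,c}F η F = 0`. Multiplying by `p_c` and
summing over `c` (`∑_c p_c² = |p|²`) and over `j`:
`|p|² ∫ V η F² = -∫ w₁ F² - 2 ∫ w₂ η F` with `w₁ = ∑ⱼ∑_c p_c sin θⱼ ∂_{j,c}η` and
`w₂ = ∑ⱼ∑_c p_c sin θⱼ ∂_{j,c}F`. The discrete Cauchy–Schwarz inequality gives pointwise
`w₁² ≤ N|p|² |∇η|²`, `w₂² ≤ N|p|² |∇F|²`, and the integral Cauchy–Schwarz inequality then gives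
`|∫ w₁ F²| ≤ √(N|p|² 𝓔_F(η,η)) √(∫F²)` and `|∫ w₂ ηF| ≤ √(N|p|² ∫|∇F|²) √(∫ η²F²)`.
All ingredients are folklore torus calculus.
-/

noncomputable section

namespace Summit.AtomisticToContinuum.BoseEinsteinCondensation.Cruxes.StaticResponseBound.FewBody

open MeasureTheory Filter
open scoped ENNReal NNReal BigOperators
open Literature.MathematicalPhysics.QuantumManyBody.BoseGas
open Summit.AtomisticToContinuum.BoseEinsteinCondensation.Theses.BECInsertionCorrector
open Summit.AtomisticToContinuum.BoseEinsteinCondensation.Theorems.StaticResponseBound.Negative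
open Summit.AtomisticToContinuum.BoseEinsteinCondensation.Cruxes.StaticResponseBound.UvThomsonForceWave

variable {N : ℕ}

/-! ## Cauchy–Schwarz inequalities (integral, on the cell, discrete) -/

/-- **Cauchy–Schwarz on the fundamental cell**: `|∫ f g| ≤ √(∫ f²) √(∫ g²)` for continuous real
`f, g` on `(ℝ³)^N` (all integrands are continuous on the bounded cell; squared form
`(∫ f g)² ≤ (∫ f²)(∫ g²)` by expanding `0 ≤ ∫ (B f - A g)²` with `A = ∫ f²`, `B = ∫ f g`).
[folklore] -/
theorem modePairing_abs_integral_mul_le {f g : Config N → ℝ} (hf : Continuous f) (hg : Continuous g)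
    (L : ℝ) :
    |∫ X in cellN N L, f X * g X| ≤
      Real.sqrt (∫ X in cellN N L, f X ^ 2) * Real.sqrt (∫ X in cellN N L, g X ^ 2) := by
  have hf2 : Integrable (fun X => f X ^ 2) (volume.restrict (cellN N L)) :=
    integrableOn_cellN (hf.pow 2) L
  have hg2 : Integrable (fun X => g X ^ 2) (volume.restrict (cellN N L)) :=
    integrableOn_cellN (hg.pow 2) L
  have hfg : Integrable (fun X => f X * g X) (volume.restrict (cellN N L)) :=
    integrableOn_cellN (hf.mul hg) L
  set A := ∫ X in cellN N L, f X ^ 2 with hA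
  set B := ∫ X in cellN N L, f X * g X with hB
  set C := ∫ X in cellN N L, g X ^ 2 with hC
  have hA0 : 0 ≤ A := integral_nonneg fun x => sq_nonneg _
  -- the squared form, adapted from Literature/Analysis/FluidPDE/HydrodynamicLimitProofs.lean
  -- (`sq_integral_mul_le_integral_sq_mul_integral_sq`)
  have hsq : B ^ 2 ≤ A * C := by
    have key : 0 ≤ A * (A * C - B ^ 2) := by
      have h1 : 0 ≤ ∫ X in cellN N L, (B * f X - A * g X) ^ 2 :=
        integral_nonneg fun x => sq_nonneg _
      have e : (fun x => (B * f x - A * g x) ^ 2) =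
          fun x => B ^ 2 * f x ^ 2 - 2 * (B * A) * (f x * g x) + A ^ 2 * g x ^ 2 := by
        funext x; ring
      have i1 : Integrable (fun x => B ^ 2 * f x ^ 2) (volume.restrict (cellN N L)) :=
        hf2.const_mul _
      have i2 : Integrable (fun x => 2 * (B * A) * (f x * g x)) (volume.restrict (cellN N L)) :=
        hfg.const_mul _
      have i12 : Integrable (fun x => B ^ 2 * f x ^ 2 - 2 * (B * A) * (f x * g x))
          (volume.restrict (cellN N L)) := i1.sub i2
      have i3 : Integrable (fun x => A ^ 2 * g x ^ 2) (volume.restrict (cellN N L)) :=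
        hg2.const_mul _
      rw [e, integral_add i12 i3, integral_sub i1 i2, integral_const_mul, integral_const_mul,
        integral_const_mul] at h1
      nlinarith
    rcases hA0.lt_or_eq with hA1 | hA1
    · nlinarith
    · have hf0 : (fun x => f x ^ 2) =ᵐ[volume.restrict (cellN N L)] 0 :=
        (integral_eq_zero_iff_of_nonneg (fun x => sq_nonneg (f x)) hf2).1 hA1.symm
      have hB0 : B = 0 := by
        have h0 : (fun x => f x * g x) =ᵐ[volume.restrict (cellN N L)] 0 := by
          filter_upwards [hf0] with x hx
          have hfx : f x = 0 := (pow_eq_zero_iff two_ne_zero).1 hx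
          simp [hfx]
        rw [hB, integral_congr_ae h0]
        simp
      rw [hB0, ← hA1]
      simp
  rw [← Real.sqrt_mul hA0]
  exact Real.abs_le_sqrt hsq

/-- **Discrete Cauchy–Schwarz for the mode gradient**: for `sⱼ² ≤ 1`,
`(∑ⱼ ∑_c p_c sⱼ b_{j,c})² ≤ (N ∑_c p_c²) · ∑ⱼ ∑_c b_{j,c}²` (Cauchy–Schwarz on `Fin N × Fin 3` and
`∑ⱼ∑_c p_c² sⱼ² ≤ N ∑_c p_c²`). [folklore] -/
theorem modePairing_sq_sum_le (p : Fin 3 → ℝ) {s : Fin N → ℝ} (hs : ∀ j, s j ^ 2 ≤ 1)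
    (b : Fin N → Fin 3 → ℝ) :
    (∑ j, ∑ c, p c * s j * b j c) ^ 2 ≤ ((N : ℝ) * ∑ c, p c ^ 2) * ∑ j, ∑ c, b j c ^ 2 := by
  have h1 : (∑ j, ∑ c, p c * s j * b j c) ^ 2 ≤
      (∑ j, ∑ c, (p c * s j) ^ 2) * ∑ j, ∑ c, b j c ^ 2 := by
    rw [← Fintype.sum_prod_type' fun j c => p c * s j * b j c,
      ← Fintype.sum_prod_type' fun j c => (p c * s j) ^ 2,
      ← Fintype.sum_prod_type' fun j c => b j c ^ 2]
    exact Finset.sum_mul_sq_le_sq_mul_sq _ _ _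
  have h2 : ∑ j, ∑ c, (p c * s j) ^ 2 ≤ (N : ℝ) * ∑ c, p c ^ 2 := by
    calc ∑ j, ∑ c, (p c * s j) ^ 2 ≤ ∑ _j : Fin N, ∑ c, p c ^ 2 :=
          Finset.sum_le_sum fun j _ => Finset.sum_le_sum fun c _ => by
            rw [mul_pow]
            exact mul_le_of_le_one_right (sq_nonneg _) (hs j)
      _ = (N : ℝ) * ∑ c, p c ^ 2 := by simp
  exact h1.trans (mul_le_mul_of_nonneg_right h2
    (Finset.sum_nonneg fun j _ => Finset.sum_nonneg fun c _ => sq_nonneg _))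

/-! ## Integration by parts against `sin θⱼ`, one particle and one axis -/

/-- **The flux identity for particle `j` and axis `c`.** For real `C¹` lattice-periodic `F, η`,
`θ = θⱼ` and `p = p_c = 2πk_c/L`:
`p ∫ cos θ η F² + ∫ sin θ ∂_{j,c}η F² + 2 ∫ sin θ ∂_{j,c}F η F = 0`
(torus integration by parts of the `C¹` periodic flux `sin θ · η F²`). [folklore] -/
theorem modePairing_axis {L : ℝ} (hL : 0 < L) {k : Fin 3 → ℤ} {F η : Config N → ℝ}
    (hF : IsPeriodicTest L F) (hη : IsPeriodicTest L η) {j : Fin N} {c : Fin 3}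
    {θ : Config N → ℝ} {p : ℝ} (hθ : ∀ X, θ X = 2 * Real.pi / L * ∑ i, (k i : ℝ) * X j i)
    (hp : p = 2 * Real.pi / L * k c) :
    p * (∫ X in cellN N L, Real.cos (θ X) * η X * F X ^ 2)
        + (∫ X in cellN N L, Real.sin (θ X) * pderiv j c η X * F X ^ 2)
        + 2 * (∫ X in cellN N L, Real.sin (θ X) * pderiv j c F X * (η X * F X)) = 0 := by
  -- adapted from `freeSq_axis` (…StaticResponseBoundFreeSquare.lean)
  obtain ⟨Θ, hΘ⟩ := freeSq_phase_clm (N := N) L k j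
  have hθΘ : θ = ⇑Θ := funext fun X => by rw [hθ, hΘ]
  subst hθΘ
  have hL0 : L ≠ 0 := hL.ne'
  -- regularity
  have hS1 : ContDiff ℝ 1 fun X => Real.sin (Θ X) := Real.contDiff_sin.comp Θ.contDiff
  have hFd : Differentiable ℝ F := hF.differentiable
  have hηd : Differentiable ℝ η := hη.differentiable
  have hF2d : Differentiable ℝ fun Y => F Y ^ 2 := (hF.1.pow 2).differentiable one_ne_zero
  have hP1 : ContDiff ℝ 1 fun X => η X * F X ^ 2 := hη.1.mul (hF.1.pow 2)
  have hFc : Continuous F := hF.continuous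
  have hηc : Continuous η := hη.continuous
  have hdFc : Continuous (pderiv j c F) := continuous_pderiv hF.1 j c
  have hdηc : Continuous (pderiv j c η) := continuous_pderiv hη.1 j c
  have hΘc : Continuous Θ := Θ.continuous
  -- the flux `G = sin θ · η F²` is `C¹` and lattice periodic
  have hG1 : ContDiff ℝ 1 fun X => Real.sin (Θ X) * (η X * F X ^ 2) := hS1.mul hP1
  have hGper : IsLatticePeriodic L fun X => Real.sin (Θ X) * (η X * F X ^ 2) := by
    intro X j' c'
    obtain ⟨m, hm⟩ :
        ∃ m : ℤ, Θ (Pi.single j' (EuclideanSpace.single c' L)) = m * (2 * Real.pi) := by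
      rcases eq_or_ne j' j with rfl | hne
      · refine ⟨k c', ?_⟩
        rw [hΘ]
        simp only [Pi.single_eq_same, PiLp.single_apply, mul_ite, mul_zero, Finset.sum_ite_eq',
          Finset.mem_univ, if_true]
        field_simp
      · refine ⟨0, ?_⟩
        rw [hΘ, Pi.single_eq_of_ne' hne]
        simp
    dsimp only
    rw [hη.2, hF.2, map_add, hm, Real.sin_add_int_mul_two_pi]
  -- integration by parts on the torus
  have hIBP := integral_cellN_pderiv_eq_zero hL hG1 hGper j c
  have hΘe : Θ (Pi.single j (EuclideanSpace.single c 1)) = p := by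
    rw [hΘ, hp]
    simp only [Pi.single_eq_same, PiLp.single_apply, mul_ite, mul_one, mul_zero,
      Finset.sum_ite_eq', Finset.mem_univ, if_true]
  have hderiv : ∀ X, pderiv j c (fun Y => Real.sin (Θ Y) * (η Y * F Y ^ 2)) X =
      p * (Real.cos (Θ X) * η X * F X ^ 2) + Real.sin (Θ X) * pderiv j c η X * F X ^ 2
        + 2 * (Real.sin (Θ X) * pderiv j c F X * (η X * F X)) := by
    intro X
    rw [pderiv_fun_mul (hS1.differentiable one_ne_zero X) (hP1.differentiable one_ne_zero X),
      pderiv_fun_mul (hηd X) (hF2d X), pderiv_fun_sq (hFd X), freeSq_pderiv_sin_clm, hΘe]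
    ring
  simp_rw [hderiv] at hIBP
  -- split the integral
  have hi1 : Integrable (fun X => p * (Real.cos (Θ X) * η X * F X ^ 2))
      (volume.restrict (cellN N L)) := integrableOn_cellN (by fun_prop) L
  have hi2 : Integrable (fun X => Real.sin (Θ X) * pderiv j c η X * F X ^ 2)
      (volume.restrict (cellN N L)) := integrableOn_cellN (by fun_prop) L
  have hi12 : Integrable (fun X => p * (Real.cos (Θ X) * η X * F X ^ 2)
      + Real.sin (Θ X) * pderiv j c η X * F X ^ 2) (volume.restrict (cellN N L)) := hi1.add hi2
  have hi3 : Integrable (fun X => 2 * (Real.sin (Θ X) * pderiv j c F X * (η X * F X)))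
      (volume.restrict (cellN N L)) := integrableOn_cellN (by fun_prop) L
  rw [integral_add hi12 hi3, integral_add hi1 hi2, integral_const_mul, integral_const_mul] at hIBP
  exact hIBP

/-! ## The identity `|p|² ∫ V η F² = -∫ w₁ F² - 2 ∫ w₂ η F` and the two pairings -/

/-- **Mode pairing, abstract weight.** For real `C¹` lattice-periodic `F, η` with `∫ F² = 1`:
`|p|² |∫ (∑ⱼ cos θⱼ) η F²| ≤ √(N|p|²) (𝓔_F(η,η)^{1/2} + 2 (∫ η²F²)^{1/2} (∫ |∇F|²)^{1/2})`.
[folklore] -/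
theorem modePairing_core {L : ℝ} (hL : 0 < L) (k : Fin 3 → ℤ) {F η : Config N → ℝ}
    (hF : IsPeriodicTest L F) (hη : IsPeriodicTest L η) (hF1 : ∫ X in cellN N L, F X ^ 2 = 1) :
    psq L k * |∫ X in cellN N L,
        (∑ j, Real.cos (2 * Real.pi / L * ∑ i, (k i : ℝ) * X j i)) * η X * F X ^ 2|
      ≤ Real.sqrt (N * psq L k) *
        (Real.sqrt (dirichletFormW L F η η) +
          2 * Real.sqrt (∫ X in cellN N L, η X ^ 2 * F X ^ 2) *
            Real.sqrt (∫ X in cellN N L, gradDot F F X)) := by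
  -- opaque names for the phases `θ j` and the momenta `p c`
  obtain ⟨θ, hθ⟩ : ∃ θ : Fin N → Config N → ℝ,
      ∀ j X, θ j X = 2 * Real.pi / L * ∑ i, (k i : ℝ) * X j i := ⟨_, fun _ _ => rfl⟩
  obtain ⟨p, hp⟩ : ∃ p : Fin 3 → ℝ, ∀ c, p c = 2 * Real.pi / L * k c := ⟨_, fun _ => rfl⟩
  have hPsum : psq L k = ∑ c, p c ^ 2 := by
    rw [freeSq_psq_eq_sum]; exact Finset.sum_congr rfl fun c _ => by rw [hp]
  have hP0 : 0 ≤ psq L k := psq_nonneg L k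
  have hNP0 : 0 ≤ (N : ℝ) * psq L k := mul_nonneg (Nat.cast_nonneg N) hP0
  -- regularity
  have hFc : Continuous F := hF.continuous
  have hηc : Continuous η := hη.continuous
  have hdFc : ∀ j c, Continuous (pderiv j c F) := fun j c => continuous_pderiv hF.1 j c
  have hdηc : ∀ j c, Continuous (pderiv j c η) := fun j c => continuous_pderiv hη.1 j c
  have hθc : ∀ j, Continuous (θ j) := fun j => by rw [funext (hθ j)]; fun_prop
  have hIcos : ∀ j, Integrable (fun X => Real.cos (θ j X) * η X * F X ^ 2)
      (volume.restrict (cellN N L)) := fun j =>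
    integrableOn_cellN ((((Real.continuous_cos.comp (hθc j)).mul hηc)).mul (hFc.pow 2)) L
  have hIA : ∀ j c, Integrable (fun X => Real.sin (θ j X) * pderiv j c η X * F X ^ 2)
      (volume.restrict (cellN N L)) := fun j c =>
    integrableOn_cellN ((((Real.continuous_sin.comp (hθc j)).mul (hdηc j c))).mul (hFc.pow 2)) L
  have hIB : ∀ j c, Integrable (fun X => Real.sin (θ j X) * pderiv j c F X * (η X * F X))
      (volume.restrict (cellN N L)) := fun j c =>
    integrableOn_cellN ((((Real.continuous_sin.comp (hθc j)).mul (hdFc j c))).mul (hηc.mul hFc)) L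
  -- the two mode gradients paired with `∇η` and `∇F`
  set w₁ : Config N → ℝ := fun X => ∑ j, ∑ c, p c * Real.sin (θ j X) * pderiv j c η X with hw₁
  set w₂ : Config N → ℝ := fun X => ∑ j, ∑ c, p c * Real.sin (θ j X) * pderiv j c F X with hw₂
  have hw₁c : Continuous w₁ := continuous_finsetSum _ fun j _ => continuous_finsetSum _
    fun c _ => (continuous_const.mul (Real.continuous_sin.comp (hθc j))).mul (hdηc j c)
  have hw₂c : Continuous w₂ := continuous_finsetSum _ fun j _ => continuous_finsetSum _
    fun c _ => (continuous_const.mul (Real.continuous_sin.comp (hθc j))).mul (hdFc j c)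
  -- pointwise Cauchy–Schwarz: `w₁² ≤ N|p|² |∇η|²`, `w₂² ≤ N|p|² |∇F|²`
  have hsin : ∀ j X, Real.sin (θ j X) ^ 2 ≤ 1 := fun j X => Real.sin_sq_le_one _
  have hw₁pt : ∀ X, w₁ X ^ 2 ≤ (N * psq L k) * gradDot η η X := by
    intro X
    have h := modePairing_sq_sum_le p (fun j => hsin j X) (fun j c => pderiv j c η X)
    rw [← hPsum] at h
    simpa only [hw₁, gradDot, sq] using h
  have hw₂pt : ∀ X, w₂ X ^ 2 ≤ (N * psq L k) * gradDot F F X := by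
    intro X
    have h := modePairing_sq_sum_le p (fun j => hsin j X) (fun j c => pderiv j c F X)
    rw [← hPsum] at h
    simpa only [hw₂, gradDot, sq] using h
  -- names for the integrals
  set I : ℝ := ∫ X in cellN N L,
    (∑ j, Real.cos (2 * Real.pi / L * ∑ i, (k i : ℝ) * X j i)) * η X * F X ^ 2 with hI
  set A : ℝ := ∫ X in cellN N L, w₁ X * F X ^ 2 with hA
  set B : ℝ := ∫ X in cellN N L, w₂ X * (η X * F X) with hB
  -- (0) the identity `|p|² I + A + 2 B = 0`
  have hident : psq L k * I + A + 2 * B = 0 := by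
    -- per particle: the axis identities weighted by `p c` and summed over `c`
    have hj : ∀ j, psq L k * (∫ X in cellN N L, Real.cos (θ j X) * η X * F X ^ 2)
        + (∑ c, p c * ∫ X in cellN N L, Real.sin (θ j X) * pderiv j c η X * F X ^ 2)
        + 2 * (∑ c, p c * ∫ X in cellN N L, Real.sin (θ j X) * pderiv j c F X * (η X * F X))
        = 0 := by
      intro j
      have h := Finset.sum_eq_zero fun c (_ : c ∈ Finset.univ) => show p c * (p c *
          (∫ X in cellN N L, Real.cos (θ j X) * η X * F X ^ 2)
          + (∫ X in cellN N L, Real.sin (θ j X) * pderiv j c η X * F X ^ 2)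
          + 2 * (∫ X in cellN N L, Real.sin (θ j X) * pderiv j c F X * (η X * F X))) = 0 by
        rw [modePairing_axis hL hF hη (hθ j) (hp c), mul_zero]
      have e : ∀ c, p c * (p c * (∫ X in cellN N L, Real.cos (θ j X) * η X * F X ^ 2)
          + (∫ X in cellN N L, Real.sin (θ j X) * pderiv j c η X * F X ^ 2)
          + 2 * (∫ X in cellN N L, Real.sin (θ j X) * pderiv j c F X * (η X * F X))) =
          p c ^ 2 * (∫ X in cellN N L, Real.cos (θ j X) * η X * F X ^ 2)
          + p c * (∫ X in cellN N L, Real.sin (θ j X) * pderiv j c η X * F X ^ 2)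
          + 2 * (p c * ∫ X in cellN N L, Real.sin (θ j X) * pderiv j c F X * (η X * F X)) :=
        fun c => by ring
      simp only [e, Finset.sum_add_distrib, ← Finset.sum_mul, ← Finset.mul_sum, ← hPsum] at h
      linarith [h]
    have hsum := Finset.sum_eq_zero fun j (_ : j ∈ Finset.univ) => hj j
    rw [Finset.sum_add_distrib, Finset.sum_add_distrib, ← Finset.mul_sum, ← Finset.mul_sum]
      at hsum
    -- identify the three sums with `I`, `A`, `B`
    have eI : ∑ j, ∫ X in cellN N L, Real.cos (θ j X) * η X * F X ^ 2 = I := by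
      rw [hI, ← integral_finsetSum _ fun j _ => hIcos j]
      refine integral_congr_ae (Eventually.of_forall fun X => ?_)
      simp only [Finset.sum_mul, hθ]
    have eA : ∑ j, ∑ c, p c * ∫ X in cellN N L, Real.sin (θ j X) * pderiv j c η X * F X ^ 2
        = A := by
      calc ∑ j, ∑ c, p c * ∫ X in cellN N L, Real.sin (θ j X) * pderiv j c η X * F X ^ 2
          = ∑ j, ∑ c, ∫ X in cellN N L, p c * (Real.sin (θ j X) * pderiv j c η X * F X ^ 2) :=
            Finset.sum_congr rfl fun j _ => Finset.sum_congr rfl fun c _ =>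
              (integral_const_mul _ _).symm
        _ = ∑ j, ∫ X in cellN N L, ∑ c, p c * (Real.sin (θ j X) * pderiv j c η X * F X ^ 2) :=
            Finset.sum_congr rfl fun j _ =>
              (integral_finsetSum _ fun c _ => (hIA j c).const_mul _).symm
        _ = ∫ X in cellN N L, ∑ j, ∑ c, p c * (Real.sin (θ j X) * pderiv j c η X * F X ^ 2) :=
            (integral_finsetSum _ fun j _ =>
              integrable_finsetSum _ fun c _ => (hIA j c).const_mul _).symm
        _ = A := by
            rw [hA]
            refine integral_congr_ae (Eventually.of_forall fun X => ?_)
            simp only [hw₁, Finset.sum_mul]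
            exact Finset.sum_congr rfl fun j _ => Finset.sum_congr rfl fun c _ => by ring
    have eB : ∑ j, ∑ c, p c * ∫ X in cellN N L, Real.sin (θ j X) * pderiv j c F X * (η X * F X)
        = B := by
      calc ∑ j, ∑ c, p c * ∫ X in cellN N L, Real.sin (θ j X) * pderiv j c F X * (η X * F X)
          = ∑ j, ∑ c, ∫ X in cellN N L,
              p c * (Real.sin (θ j X) * pderiv j c F X * (η X * F X)) :=
            Finset.sum_congr rfl fun j _ => Finset.sum_congr rfl fun c _ =>
              (integral_const_mul _ _).symm
        _ = ∑ j, ∫ X in cellN N L,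
              ∑ c, p c * (Real.sin (θ j X) * pderiv j c F X * (η X * F X)) :=
            Finset.sum_congr rfl fun j _ =>
              (integral_finsetSum _ fun c _ => (hIB j c).const_mul _).symm
        _ = ∫ X in cellN N L,
              ∑ j, ∑ c, p c * (Real.sin (θ j X) * pderiv j c F X * (η X * F X)) :=
            (integral_finsetSum _ fun j _ =>
              integrable_finsetSum _ fun c _ => (hIB j c).const_mul _).symm
        _ = B := by
            rw [hB]
            refine integral_congr_ae (Eventually.of_forall fun X => ?_)
            simp only [hw₂, Finset.sum_mul]
            exact Finset.sum_congr rfl fun j _ => Finset.sum_congr rfl fun c _ => by ring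
    rw [eI, eA, eB] at hsum
    exact hsum
  -- (1) the pairing with `∇η`: `|A| ≤ √(N|p|²) √𝓔_F(η,η)`
  have hAbd : |A| ≤ Real.sqrt (N * psq L k) * Real.sqrt (dirichletFormW L F η η) := by
    have hA' : A = ∫ X in cellN N L, (w₁ X * F X) * F X := by
      rw [hA]; exact integral_congr_ae (Eventually.of_forall fun X => by ring)
    have hc : Continuous fun X => w₁ X * F X := hw₁c.mul hFc
    have h1 := modePairing_abs_integral_mul_le hc hFc L
    rw [← hA', hF1, Real.sqrt_one, mul_one] at h1
    refine h1.trans ?_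
    rw [← Real.sqrt_mul hNP0]
    refine Real.sqrt_le_sqrt ?_
    rw [dirichletFormW_def, ← integral_const_mul]
    refine integral_mono_of_nonneg (Eventually.of_forall fun X => sq_nonneg _)
      ((integrableOn_gradDot_mul_sq hFc hη.1 hη.1 L).const_mul _)
      (Eventually.of_forall fun X => ?_)
    have h := mul_le_mul_of_nonneg_right (hw₁pt X) (sq_nonneg (F X))
    calc (w₁ X * F X) ^ 2 = w₁ X ^ 2 * F X ^ 2 := by ring
      _ ≤ N * psq L k * gradDot η η X * F X ^ 2 := h
      _ = N * psq L k * (gradDot η η X * F X ^ 2) := by ring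
  -- (2) the pairing with `∇F`: `|B| ≤ √(N|p|²) √(∫|∇F|²) √(∫ η²F²)`
  have hBbd : |B| ≤ Real.sqrt (N * psq L k) * Real.sqrt (∫ X in cellN N L, gradDot F F X) *
      Real.sqrt (∫ X in cellN N L, η X ^ 2 * F X ^ 2) := by
    have hc : Continuous fun X => η X * F X := hηc.mul hFc
    have h1 := modePairing_abs_integral_mul_le hw₂c hc L
    refine h1.trans ?_
    have e2 : ∫ X in cellN N L, (η X * F X) ^ 2 = ∫ X in cellN N L, η X ^ 2 * F X ^ 2 :=
      integral_congr_ae (Eventually.of_forall fun X => by ring)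
    rw [e2, ← Real.sqrt_mul hNP0]
    refine mul_le_mul_of_nonneg_right (Real.sqrt_le_sqrt ?_) (Real.sqrt_nonneg _)
    rw [← integral_const_mul]
    exact integral_mono_of_nonneg (Eventually.of_forall fun X => sq_nonneg _)
      ((integrableOn_cellN (continuous_gradDot hF.1 hF.1) L).const_mul _)
      (Eventually.of_forall hw₂pt)
  -- (3) assemble
  have hIeq : psq L k * I = -(A + 2 * B) := by linear_combination hident
  calc psq L k * |I| = |psq L k * I| := by rw [abs_mul, abs_of_nonneg hP0]
    _ = |A + 2 * B| := by rw [hIeq, abs_neg]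
    _ ≤ |A| + 2 * |B| := by
        have h := abs_add_le A (2 * B)
        rwa [abs_mul, abs_two] at h
    _ ≤ Real.sqrt (N * psq L k) * Real.sqrt (dirichletFormW L F η η) +
          2 * (Real.sqrt (N * psq L k) * Real.sqrt (∫ X in cellN N L, gradDot F F X) *
            Real.sqrt (∫ X in cellN N L, η X ^ 2 * F X ^ 2)) := by linarith
    _ = _ := by ring

/-! ## The stub -/

/-- **Mode pairing** (stub `stub_modePairing`, verbatim `ModePairing`): for a real nonnegative
periodic trial state `Φ` (`F = |Φ|`), a real `C¹` lattice-periodic `η` and `V = ∑ⱼ cos(p·xⱼ)`,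
`p = 2πk/L`: `|p|²·|∫ V η F²| ≤ √(N|p|²)·(𝓔_F(η,η)^{1/2} + 2 (∫η²F²)^{1/2} (∫|∇F|²)^{1/2})`
(`modePairing_core` with `F = |Φ|`, which is `C¹` by `contDiff_norm_of_real`, lattice periodic,
and normalised by `integral_norm_sq_eq_one`). [folklore] -/
theorem stub_modePairing :
    ∀ (N : ℕ) (L : ℝ), 0 < L → ∀ (k : Fin 3 → ℤ) (Φ : PeriodicTrialState N L),
      (∀ X, Φ.ψ X = (‖Φ.ψ X‖ : ℂ)) →
      ∀ η : Config N → ℝ, IsPeriodicTest L η →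
        psq L k * |∫ X in cellN N L,
            (∑ j, Real.cos (2 * Real.pi / L * ∑ i, (k i : ℝ) * X j i)) * η X * ‖Φ.ψ X‖ ^ 2|
          ≤ Real.sqrt (N * psq L k) *
            (Real.sqrt (dirichletFormW L (fun X => ‖Φ.ψ X‖) η η) +
              2 * Real.sqrt (∫ X in cellN N L, η X ^ 2 * ‖Φ.ψ X‖ ^ 2) *
                Real.sqrt (∫ X in cellN N L, gradDot (fun Y => ‖Φ.ψ Y‖) (fun Y => ‖Φ.ψ Y‖) X)) := by
  intro N L hL k Φ hreal η hη
  have hF : IsPeriodicTest L fun X => ‖Φ.ψ X‖ :=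
    ⟨contDiff_norm_of_real Φ hreal, fun X i a => by simp only [Φ.periodic X i a]⟩
  exact modePairing_core hL k hF hη (integral_norm_sq_eq_one Φ)

end Summit.AtomisticToContinuum.BoseEinsteinCondensation.Cruxes.StaticResponseBound.FewBody

end
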